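import Literature.NumberTheory.GaloisCohomology.Howard2004.DVRSettingPiRefinement
import Literature.NumberTheory.GaloisCohomology.Howard2004.LevelQuotientProofs
import Literature.NumberTheory.GaloisCohomology.Howard2004.PropagateTowerProofs
import Literature.NumberTheory.GaloisCohomology.Howard2004.DVRLevelSelmerFiniteProofs
import Literature.NumberTheory.GaloisCohomology.Howard2004.QuotCartesianReductionProofs
import Literature.NumberTheory.GaloisCohomology.Howard2004.CohomologyMapBijectiveTransportProofs
import HarnessLib

/-!
# Howard 2004, §1.6 with Rem. 1.3.1: the Selmer structures and Selmer triples of the `π`-adic refinement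
# of a `DVRSetting` (propagation to `T/π^jT`), H.2 and the prime sets on the refined tower
# (definitions with bodies + theorems)

B. Howard, *The Heegner point Kolyvagin system*, Compositio Math. **140** (2004) (arXiv:1202.6340).  Proof of
Thm. 1.6.1 (arXiv p. 11 L33–38): «the Selmer triple `(T^{(k)}, F, 𝓛^{(k)})`», `F` on `T^{(k)} = T/𝔪^k T` being
«propagated from `T`» (Def. 1.1.3, p. 5 L98–99); Rem. 1.3.1 (p. 7 L125–127): H.0–H.5 are stable under base
change.  Brick (R3a) of the refinement constructor (REFINE, cell `pub/bsd-print-x9`; R1 =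
`DVRSettingPiRefinement`: `D = S.piRefinementDatum hy`, `D.Level j = T/π^jT` hosted on `T^{(host j)}`,
`S.refinedTower hy`):

* §1 two-index forms of the setting's compatibilities: `cond_redLE` (the local conditions reduce ONTO each
  other along `T^{(k')} ↠ T^{(k)}`), `πbar_redLE`;
* §2 **`DVRSetting.refinedCond S hy j : SelmerStructure (D.levelRep j)`** — `F` propagated to `T/π^jT` from its
  host level (`IsQuotientBy.propagateStructure` along `D.proj`), and its HOST-INDEPENDENCE `refinedCond_eq_of_le`
  (propagating from any level `k ≥ host j` gives the same structure: `propagateStructure_eq_of_comp` + §1);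
* §3 **`DVRSetting.refinedTriple S hy j : SelmerTriple p (D.levelRep j)`** (`j ≥ 1`: same `Σ(F)`, same `𝓛`; Howard
  structure: the propagated unramified condition is unramified, `PropagateUnramifiedProofs`);
* §4 the tower compatibilities of the refined setting: `refinedCond_map_red` (`cond_red♯`: `F` on `T/π^{j+1}`
  reduces ONTO `F` on `T/π^j`), `refinedCond_smul` (`cond_smul♯`: `R`-stability), `refinedCond_eq_unramified`;
* §5 **H.2 for the refined tower** (`h2Tower_refinedTower`) and the prime sets: `degreeTwoPrimes_subset_refinedTower`,
  `kolyvaginPrimes_subset_refinedTower`, hence **`largePrimes`-transfer** `refined_largePrimes_aux`;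
* §6 (COFINAL letter `hιF`) **`mem_cond_iff_proj_mem_refinedCond`**: at a marked index `i = e_k`, a local class of
  `T^{(k)}` lies in `F` iff its image under the bijection `H¹(proj)` lies in the refined condition.

Definitions with bodies and theorems only: no named fact, no instance, no notation, no `sorry`.  H.3/H.4/H.5 of the
refined levels are NOT here (R3b/R4/R2b).  `thm161_dvrKolyvaginBound` is NOT proved here; BSD is not proved by any of this.
-/

set_option autoImplicit false

noncomputable section

open Function NumberField IsDedekindDomain Field
open scoped NumberField ContRepresentation Classical

namespace Literature.NumberTheory.GaloisCohomology.Howard2004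

open Literature.NumberTheory.GaloisRepresentations
open Literature.NumberTheory.GaloisRepresentations.DiscreteGaloisModule

namespace DVRSetting

variable {p : ℕ} [Fact p.Prime] {K : Type} [Field K] [NumberField K]
  {R : Type} [CommRing R] [IsDomain R] [IsDiscreteValuationRing R] [Algebra ℤ_[p] R]
  {N : ℕ → Type} [∀ k, AddCommGroup (N k)] [∀ k, TopologicalSpace (N k)]
  [∀ k, DiscreteTopology (N k)] [∀ k, Module R (N k)]
  {Rk : ℕ → Type} [∀ k, CommRing (Rk k)] [∀ k, IsLocalRing (Rk k)] [∀ k, TopologicalSpace (Rk k)]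
  [∀ k, DiscreteTopology (Rk k)] [∀ k, Algebra ℤ_[p] (Rk k)] [∀ k, Algebra R (Rk k)]
  [∀ k, Module (Rk k) (N k)] [∀ k, IsScalarTower R (Rk k) (N k)]
  {Nbar : Type} [AddCommGroup Nbar] [TopologicalSpace Nbar] [DiscreteTopology Nbar]
  [∀ k, Module (Rk k) Nbar]
  {Nq : ℕ → Finset (HeightOneSpectrum (𝓞 K)) → Type} [∀ k n, AddCommGroup (Nq k n)]
  [∀ k n, TopologicalSpace (Nq k n)] [∀ k n, DiscreteTopology (Nq k n)]
  [∀ k n, Module (Rk k) (Nq k n)] [∀ k n, Module R (Nq k n)]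
  [∀ k n, IsScalarTower R (Rk k) (Nq k n)]

/-! ## §1 Two-index compatibilities of the setting -/

/-- `H¹(K_v, ·)` of the two-index reduction `T^{(k')} ↠ T^{(k)}`. [cite: Howard2004HeegnerKolyvagin, §1.6 (arXiv p. 12, L29–33)] -/
abbrev redLELoc (S : DVRSetting p K R N Rk Nbar Nq) {k k' : ℕ} (h : k ≤ k') (v : Place K) :
    galoisCohomology ((S.T.ρ k').toLocal v) 1 →+ galoisCohomology ((S.T.ρ k).toLocal v) 1 :=
  ContinuousRep.cohomologyMap ((S.T.ρ k').toLocal v) ((S.T.ρ k).toLocal v) (S.T.redLE h).toAddMonoidHom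
    continuous_of_discreteTopology (fun _ x => S.T.redLE_equivariant h _ x) 1

/-- **The local conditions reduce ONTO each other along `T^{(k')} ↠ T^{(k)}`** (`cond_red` iterated):
`(F_{k'} v).map H¹(redLE) = F_k v`. [cite: Howard2004HeegnerKolyvagin, §1.6 (arXiv p. 11 L33–38: F on T^{(k)} propagated from T)] -/
theorem cond_redLE (S : DVRSetting p K R N Rk Nbar Nq) (hy : S.SatisfiesH) {k k' : ℕ} (h : k ≤ k')
    (v : Place K) : ((S.t k').cond v).map (S.redLELoc h v) = (S.t k).cond v := by
  induction k', h using Nat.le_induction with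
  | base =>
    ext x
    constructor
    · rintro ⟨y, hy', rfl⟩
      rwa [show S.redLELoc (le_refl k) v y = y from
        (cohomologyMap_one_congr_apply _ _ _ (AddMonoidHom.id _) _ (fun _ _ => rfl)
          (fun z => S.T.redLE_self k z) y).trans (cohomologyMap_id_apply _ y)]
    · intro hx
      exact ⟨x, hx, (cohomologyMap_one_congr_apply _ _ _ (AddMonoidHom.id _) _ (fun _ _ => rfl)
          (fun z => S.T.redLE_self k z) x).trans (cohomologyMap_id_apply _ x)⟩
  | succ k' h ih =>
    have hcomp : ∀ y, S.redLELoc (Nat.le_succ_of_le h) v y =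
        S.redLELoc h v (ContinuousRep.cohomologyMap ((S.T.ρ (k' + 1)).toLocal v) ((S.T.ρ k').toLocal v)
          (S.T.red k').toAddMonoidHom continuous_of_discreteTopology (fun _ x => S.T.red_equivariant k' _ x) 1 y) :=
      fun y => (cohomologyMap_one_comp_apply ((S.T.ρ (k' + 1)).toLocal v) ((S.T.ρ k').toLocal v)
        ((S.T.ρ k).toLocal v) (S.T.red k').toAddMonoidHom (fun _ x => S.T.red_equivariant k' _ x)
        (S.T.redLE h).toAddMonoidHom (fun _ x => S.T.redLE_equivariant h _ x)
        (S.T.redLE (Nat.le_succ_of_le h)).toAddMonoidHom (fun _ x => S.T.redLE_equivariant (Nat.le_succ_of_le h) _ x)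
        (fun x => (S.T.redLE_succ h x).symm) y).symm
    calc ((S.t (k' + 1)).cond v).map (S.redLELoc (Nat.le_succ_of_le h) v)
        = ((S.t (k' + 1)).cond v).map ((S.redLELoc h v).comp
            (ContinuousRep.cohomologyMap ((S.T.ρ (k' + 1)).toLocal v)
              ((S.T.ρ k').toLocal v) (S.T.red k').toAddMonoidHom continuous_of_discreteTopology
              (fun _ x => S.T.red_equivariant k' _ x) 1)) :=
          congrArg (fun f => AddSubgroup.map f ((S.t (k' + 1)).cond v)) (AddMonoidHom.ext hcomp)
      _ = (((S.t (k' + 1)).cond v).map (ContinuousRep.cohomologyMap ((S.T.ρ (k' + 1)).toLocal v)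
            ((S.T.ρ k').toLocal v) (S.T.red k').toAddMonoidHom continuous_of_discreteTopology
            (fun _ x => S.T.red_equivariant k' _ x) 1)).map (S.redLELoc h v) := (AddSubgroup.map_map _ _ _).symm
      _ = ((S.t k').cond v).map (S.redLELoc h v) := congrArg (fun L => L.map (S.redLELoc h v)) (hy.cond_red k' v)
      _ = (S.t k).cond v := ih

/-- **The residual presentations are compatible with the two-index reductions**: `π̄_k (redLE y) = π̄_{k'} y`
(`πbar_red` iterated). [cite: Howard2004HeegnerKolyvagin, §1.6 (arXiv p. 11, L33–38)] -/
theorem πbar_redLE (S : DVRSetting p K R N Rk Nbar Nq) (hy : S.SatisfiesH) {k k' : ℕ} (h : k ≤ k') (y : N k') :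
    S.πbar k (S.T.redLE h y) = S.πbar k' y := by
  induction k', h using Nat.le_induction with
  | base => rw [AdicTower.redLE_self]
  | succ k' h ih => rw [AdicTower.redLE_succ _ h, ih, hy.πbar_red]

/-! ## §2 The Selmer structure propagated to `T/π^jT` -/

/-- **`F` on `T/π^jT`**: the Selmer structure of the host level propagated along the presentation
`proj : T^{(host j)} ↠ T/π^jT` (Def. 1.1.3). [cite: Howard2004HeegnerKolyvagin, Def. 1.1.3 and §1.6 (arXiv p. 5 L98–99, p. 11 L33–38)] -/
def refinedCond (S : DVRSetting p K R N Rk Nbar Nq) (hy : S.SatisfiesH) (j : ℕ) :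
    SelmerStructure ((S.piRefinementDatum hy).levelRep j) :=
  ((S.piRefinementDatum hy).isQuotientBy_levelRep (le_refl ((S.piRefinementDatum hy).host j))).propagateStructure
    (S.t ((S.piRefinementDatum hy).host j)).cond

/-- **Host independence**: propagating `F` from ANY level `k ≥ host j` to `T/π^jT` gives `refinedCond` (the
conditions reduce onto each other, §1). [cite: Howard2004HeegnerKolyvagin, Def. 1.1.3 and §1.6 (arXiv p. 5 L98–99, p. 11 L33–38)] -/
theorem refinedCond_eq_of_le (S : DVRSetting p K R N Rk Nbar Nq) (hy : S.SatisfiesH) {j k : ℕ}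
    (h : (S.piRefinementDatum hy).host j ≤ k) :
    ((S.piRefinementDatum hy).isQuotientBy_levelRep h).propagateStructure (S.t k).cond = S.refinedCond hy j :=
  IsQuotientBy.propagateStructure_eq_of_comp _ _ (S.T.redLE h).toAddMonoidHom
    (fun g x => S.T.redLE_equivariant h g x)
    (fun x => ((S.piRefinementDatum hy).proj_red le_rfl h x).symm) _ _ (fun v => S.cond_redLE hy h v)

/-- Unfolding at a place: `refinedCond j v` is the image of `F_k v` under `H¹(K_v, proj)` for any `k ≥ host j`.
[cite: Howard2004HeegnerKolyvagin, Def. 1.1.3 (arXiv p. 5, L98–99)] -/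
theorem refinedCond_apply_eq_map (S : DVRSetting p K R N Rk Nbar Nq) (hy : S.SatisfiesH) {j k : ℕ}
    (h : (S.piRefinementDatum hy).host j ≤ k) (v : Place K) :
    S.refinedCond hy j v = ((S.t k).cond v).map
      (((S.piRefinementDatum hy).isQuotientBy_levelRep h).localCohomologyMap v 1) := by
  rw [← S.refinedCond_eq_of_le hy h, IsQuotientBy.propagateStructure_apply]

/-! ## §3 The Selmer triple `(T/π^jT, F, 𝓛)` -/

/-- `T^{(k)}` is unramified outside `Σ(F)`. [cite: Howard2004HeegnerKolyvagin, Def. 1.1.10 (arXiv p. 6, L10–14)] -/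
theorem isUnramifiedAt_of_not_mem_Sigma (S : DVRSetting p K R N Rk Nbar Nq) (hy : S.SatisfiesH) (k : ℕ)
    {v : HeightOneSpectrum (𝓞 K)} (hv : (Sum.inr v : Place K) ∉ S.Sigma) : GaloisRep.IsUnramifiedAt v (S.T.ρ k) := by
  by_contra h
  exact hv (hy.Sigma_eq k ▸ (S.t k).isHoward.mem_of_ramified v h)

/-- **`(T/π^jT, F, 𝓛)` is a Selmer triple in Howard's sense** (`j` with a host level; same `Σ(F)` and `𝓛` as the
setting): the propagated unramified condition is unramified (`PropagateUnramifiedProofs`), `Σ` contains `p` and the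
ramified places, `𝓛 ⊆ 𝓛₀(T/π^jT)`. [cite: Howard2004HeegnerKolyvagin, Def. 1.1.10, §1.2 and §1.6 (arXiv p. 6 L10–24 and L96–100, p. 11 L33–38)] -/
def refinedTriple (S : DVRSetting p K R N Rk Nbar Nq) (hy : S.SatisfiesH) (j : ℕ) :
    SelmerTriple p ((S.piRefinementDatum hy).levelRep j) where
  cond := S.refinedCond hy j
  Sigma := S.Sigma
  isHoward :=
    { isUnramifiedOutside := by
        refine ⟨fun w => hy.Sigma_eq ((S.piRefinementDatum hy).host j) ▸
          (S.t _).isHoward.isUnramifiedOutside.1 w, fun v hv => ?_⟩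
        haveI := S.finite_level hy ((S.piRefinementDatum hy).host j)
        exact IsQuotientBy.propagateStructure_inr_eq_unramifiedSubgroup _ _
          ((S.t _).isHoward.isUnramifiedOutside.2 v (hy.Sigma_eq _ ▸ hv)) (S.isUnramifiedAt_of_not_mem_Sigma hy _ hv)
      mem_of_dvd := fun v hv => hy.Sigma_eq ((S.piRefinementDatum hy).host j) ▸ (S.t _).isHoward.mem_of_dvd v hv
      mem_of_ramified := fun v hv => by
        by_contra h
        exact hv (((S.piRefinementDatum hy).isQuotientBy_levelRep le_rfl).isUnramifiedAt
          (S.isUnramifiedAt_of_not_mem_Sigma hy _ h)) }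
  primes := S.L
  primes_subset := fun v hv =>
    ((S.piRefinementDatum hy).isQuotientBy_levelRep le_rfl).degreeTwoPrimes_subset_degreeTwoPrimes p
      (Set.mem_iInter.mp (hy.L_subset hv) _)
  disjoint := hy.L_disjoint

/-- Unfolding: the condition of the refined triple. [cite: Howard2004HeegnerKolyvagin, §1.6 (arXiv p. 11, L33–38)] -/
@[simp] theorem refinedTriple_cond (S : DVRSetting p K R N Rk Nbar Nq) (hy : S.SatisfiesH) (j : ℕ) :
    (S.refinedTriple hy j).cond = S.refinedCond hy j := rfl

/-- Unfolding: `Σ(F)` of the refined triple. [cite: Howard2004HeegnerKolyvagin, §1.6 (arXiv p. 11, L33–38)] -/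
@[simp] theorem refinedTriple_Sigma (S : DVRSetting p K R N Rk Nbar Nq) (hy : S.SatisfiesH) (j : ℕ) :
    (S.refinedTriple hy j).Sigma = S.Sigma := rfl

/-- Unfolding: `𝓛` of the refined triple. [cite: Howard2004HeegnerKolyvagin, §1.6 (arXiv p. 11, L33–38)] -/
@[simp] theorem refinedTriple_primes (S : DVRSetting p K R N Rk Nbar Nq) (hy : S.SatisfiesH) (j : ℕ) :
    (S.refinedTriple hy j).primes = S.L := rfl

/-! ## §4 Tower compatibilities of the refined structures -/

/-- `H¹(K_v, ·)` of the refinement map `map a b`. [cite: Howard2004HeegnerKolyvagin, Def. 1.1.3 (arXiv p. 5, L93–99)] -/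
abbrev refinedMapLoc (S : DVRSetting p K R N Rk Nbar Nq) (hy : S.SatisfiesH) (a b : ℕ) (v : Place K) :
    galoisCohomology (((S.piRefinementDatum hy).levelRep a).toLocal v) 1 →+
      galoisCohomology (((S.piRefinementDatum hy).levelRep b).toLocal v) 1 :=
  ContinuousRep.cohomologyMap (((S.piRefinementDatum hy).levelRep a).toLocal v)
    (((S.piRefinementDatum hy).levelRep b).toLocal v) ((S.piRefinementDatum hy).map a b).toAddMonoidHom
    continuous_of_discreteTopology (fun _ x => (S.piRefinementDatum hy).map_equivariant a b _ x) 1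

/-- **`cond_red♯`: `F` on `T/π^{j'}T` reduces ONTO `F` on `T/π^jT`** for `j ≤ j'` (propagation from a common host
through `proj_j = map j' j ∘ proj_{j'}`). [cite: Howard2004HeegnerKolyvagin, Def. 1.1.3 and §1.6 (arXiv p. 5 L98–99, p. 11 L33–38)] -/
theorem refinedCond_map_of_le (S : DVRSetting p K R N Rk Nbar Nq) (hy : S.SatisfiesH) {j j' : ℕ} (hjj' : j ≤ j')
    (v : Place K) : (S.refinedCond hy j' v).map (S.refinedMapLoc hy j' j v) = S.refinedCond hy j v := by
  set k := (S.piRefinementDatum hy).host j'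
  have hk : (S.piRefinementDatum hy).host j ≤ k := (S.piRefinementDatum hy).host_mono hjj'
  rw [S.refinedCond_apply_eq_map hy (le_refl k) v, S.refinedCond_apply_eq_map hy hk v, AddSubgroup.map_map]
  congr 1
  refine AddMonoidHom.ext fun y => ?_
  have hpt : ∀ x : N k, (S.piRefinementDatum hy).map j' j ((S.piRefinementDatum hy).proj le_rfl x) =
      (S.piRefinementDatum hy).proj hk x := fun x => by
    rw [(S.piRefinementDatum hy).map_proj j' j le_rfl hk, Nat.sub_eq_zero_of_le hjj', pow_zero, one_smul]
  exact cohomologyMap_one_comp_apply ((S.T.ρ k).toLocal v) (((S.piRefinementDatum hy).levelRep j').toLocal v)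
    (((S.piRefinementDatum hy).levelRep j).toLocal v)
    ((S.piRefinementDatum hy).proj (le_refl k)).toAddMonoidHom
    (fun _ x => ((S.piRefinementDatum hy).isQuotientBy_levelRep (le_refl k)).equivariant _ x)
    ((S.piRefinementDatum hy).map j' j).toAddMonoidHom (fun _ x => (S.piRefinementDatum hy).map_equivariant j' j _ x)
    ((S.piRefinementDatum hy).proj hk).toAddMonoidHom
    (fun _ x => ((S.piRefinementDatum hy).isQuotientBy_levelRep hk).equivariant _ x) hpt y

/-- `cond_red♯` for consecutive levels of the refined tower, in the shape of `SatisfiesH.cond_red`.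
[cite: Howard2004HeegnerKolyvagin, §1.6 (arXiv p. 11, L33–38)] -/
theorem refinedCond_map_red (S : DVRSetting p K R N Rk Nbar Nq) (hy : S.SatisfiesH) (i : ℕ) (v : Place K) :
    (S.refinedCond hy (i + 1 + 1) v).map
      (ContinuousRep.cohomologyMap (((S.refinedTower hy).ρ (i + 1)).toLocal v) (((S.refinedTower hy).ρ i).toLocal v)
        ((S.refinedTower hy).red i).toAddMonoidHom continuous_of_discreteTopology
        (fun _ x => (S.refinedTower hy).red_equivariant i _ x) 1) = S.refinedCond hy (i + 1) v := by
  exact S.refinedCond_map_of_le hy (Nat.le_succ (i + 1)) v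

/-- **`cond_smul♯`: the refined conditions are `R`-submodules** (images of `R`-stable conditions under `H¹` of an
`R`-linear map). [cite: Howard2004HeegnerKolyvagin, Def. 1.1.1 (arXiv p. 5, L20–21)] -/
theorem refinedCond_smul (S : DVRSetting p K R N Rk Nbar Nq) (hy : S.SatisfiesH) (j : ℕ) (v : Place K) (r : R) :
    (S.refinedCond hy j v).map (galoisCohomology.scalarMapH1 (((S.piRefinementDatum hy).levelRep j).toLocal v)
      (((S.piRefinementDatum hy).isScalarLinear_levelRep j).restrictField _) r) ≤ S.refinedCond hy j v := by
  set k := (S.piRefinementDatum hy).host j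
  rw [S.refinedCond_apply_eq_map hy (le_refl k) v]
  exact map_scalarMapH1_map_le ((S.T.ρ k).toLocal v) ((S.T.hlin k).restrictField _)
    (((S.piRefinementDatum hy).levelRep j).toLocal v) (((S.piRefinementDatum hy).isScalarLinear_levelRep j).restrictField _)
    ((S.piRefinementDatum hy).proj (le_refl k))
    (fun _ x => ((S.piRefinementDatum hy).isQuotientBy_levelRep (le_refl k)).equivariant _ x) ((S.t k).cond v)
    (fun r => hy.cond_smul k v r) r

/-- Outside `Σ(F)` the refined condition is the unramified one. [cite: Howard2004HeegnerKolyvagin, Def. 1.1.10 (arXiv p. 6, L10–14)] -/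
theorem refinedCond_eq_unramified (S : DVRSetting p K R N Rk Nbar Nq) (hy : S.SatisfiesH) (j : ℕ)
    {v : HeightOneSpectrum (𝓞 K)} (hv : (Sum.inr v : Place K) ∉ S.Sigma) :
    S.refinedCond hy j (Sum.inr v) =
      unramifiedSubgroup (GaloisRep.toLocal v ((S.piRefinementDatum hy).levelRep j)) 1 :=
  (S.refinedTriple hy j).isHoward.isUnramifiedOutside.2 v hv

/-! ## §5 H.2 and the prime sets of the refined tower -/

omit [NumberField K] [IsDomain R] [IsDiscreteValuationRing R] [Algebra ℤ_[p] R] in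
/-- A linear map carries `I·M` into `I·M'`. [folklore] -/
private theorem map_mem_smul_top_aux {M₁ M₂ : Type} [AddCommGroup M₁] [Module R M₁] [AddCommGroup M₂] [Module R M₂]
    (f : M₁ →ₗ[R] M₂) (I : Ideal R) {z : M₁} (hz : z ∈ I • (⊤ : Submodule R M₁)) : f z ∈ I • (⊤ : Submodule R M₂) := by
  have h := Submodule.mem_map_of_mem (f := f) hz
  rw [Submodule.map_smul''] at h
  exact Submodule.smul_mono le_rfl le_top h

/-- **H.2 for the refined tower**: the field `F` of H.2 for `T` (acting trivially on every `T^{(k)}`) acts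
trivially on every `T/π^jT`. [cite: Howard2004HeegnerKolyvagin, H.2 (arXiv p. 7, L61–63)] -/
theorem h2Tower_refinedTower (S : DVRSetting p K R N Rk Nbar Nq) (hy : S.SatisfiesH) :
    (S.refinedTower hy).H2Tower p S.cd S.ρbar := by
  obtain ⟨ΓF, hnorm, hclosed, hconj, htriv, hinj⟩ := hy.h2
  refine ⟨ΓF, hnorm, hclosed, hconj, fun i g hg x => ?_, hinj⟩
  obtain ⟨y, rfl⟩ := (S.piRefinementDatum hy).proj_surjective (le_refl ((S.piRefinementDatum hy).host (i + 1))) x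
  change (S.piRefinementDatum hy).levelRep (i + 1) g _ = _
  rw [← ((S.piRefinementDatum hy).isQuotientBy_levelRep le_rfl).equivariant]
  exact congrArg _ (htriv _ g hg y)

/-- `𝓛₀(T) ⊆ 𝓛₀` of the refined tower. [cite: Howard2004HeegnerKolyvagin, §1.2 (arXiv p. 6, L54–56)] -/
theorem degreeTwoPrimes_subset_refinedTower (S : DVRSetting p K R N Rk Nbar Nq) (hy : S.SatisfiesH) :
    S.T.degreeTwoPrimes p ⊆ (S.refinedTower hy).degreeTwoPrimes p := by
  intro v hv
  simp only [AdicTower.degreeTwoPrimes, Set.mem_iInter] at hv ⊢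
  exact fun i => ((S.piRefinementDatum hy).isQuotientBy_levelRep le_rfl).degreeTwoPrimes_subset_degreeTwoPrimes p (hv _)

/-- `𝓛_s(T) ⊆ 𝓛_s` of the refined tower (a Frobenius trivial modulo `p^s` on every `T^{(k)}` is trivial modulo
`p^s` on every quotient `T/π^jT`). [cite: Howard2004HeegnerKolyvagin, Def. 1.2.1 (arXiv p. 6, L63–68)] -/
theorem kolyvaginPrimes_subset_refinedTower (S : DVRSetting p K R N Rk Nbar Nq) (hy : S.SatisfiesH) (s : ℕ) :
    S.T.kolyvaginPrimes p s ⊆ (S.refinedTower hy).kolyvaginPrimes p s := by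
  rintro v ⟨h0, h1, h2⟩
  refine ⟨S.degreeTwoPrimes_subset_refinedTower hy h0, h1, fun i σ hσ x => ?_⟩
  obtain ⟨y, rfl⟩ := (S.piRefinementDatum hy).proj_surjective (le_refl ((S.piRefinementDatum hy).host (i + 1))) x
  change (S.piRefinementDatum hy).levelRep (i + 1) σ _ - _ ∈ _
  rw [← ((S.piRefinementDatum hy).isQuotientBy_levelRep le_rfl).equivariant, ← map_sub]
  exact map_mem_smul_top_aux _ _ (h2 _ σ hσ y)

/-- **`𝓛_s(T) ⊂ 𝓛` for `s ≫ 0` transfers to the refined tower** (with the same `𝓛`).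
[cite: Howard2004HeegnerKolyvagin, §1.6 (arXiv p. 11, L15–16)] -/
theorem exists_kolyvaginPrimes_refinedTower_subset (S : DVRSetting p K R N Rk Nbar Nq) (hy : S.SatisfiesH)
    (hL : S.LargePrimes) : ∃ s₀ : ℕ, ∀ s, s₀ ≤ s → ∀ v ∈ (S.refinedTower hy).kolyvaginPrimes p s,
      v ∈ S.T.degreeTwoPrimes p → v ∈ S.L := by
  obtain ⟨s₀, hs₀⟩ := hL
  refine ⟨s₀, fun s hs v hv hv0 => hs₀ s hs ⟨hv0, hv.2.1, fun k σ hσ x => ?_⟩⟩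
  -- read the congruence on `T^{(k)}` through the marked level `T^{(k)} ≅ T/π^{e_k}T`
  have hb := S.proj_bijective_of_eq_e hy (rfl : S.e k = S.e k)
  have h := hv.2.2 (S.e k - 1) σ hσ
  have he : S.e k - 1 + 1 = S.e k := Nat.sub_add_cancel (hy.e_zero.trans_le (hy.e_strictMono.monotone (Nat.zero_le k)))
  -- transport along `proj : T^{(k)} → Level (e_k - 1 + 1)`
  have hhost : (S.piRefinementDatum hy).host (S.e k - 1 + 1) ≤ k := S.host_le_of_eq_e hy he
  have hinj : Function.Injective ((S.piRefinementDatum hy).proj hhost) := (S.proj_bijective_of_eq_e hy he).1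
  have hx := h ((S.piRefinementDatum hy).proj hhost x)
  change (S.piRefinementDatum hy).levelRep _ σ _ - _ ∈ _ at hx
  rw [← ((S.piRefinementDatum hy).isQuotientBy_levelRep hhost).equivariant, ← map_sub,
    ← LinearMap.range_eq_top.mpr ((S.piRefinementDatum hy).proj_surjective hhost), ← Submodule.map_top,
    ← Submodule.map_smul'', Submodule.mem_map] at hx
  obtain ⟨z, hz, hzx⟩ := hx
  have hz' : z = S.T.ρ k σ x - x := hinj hzx
  rw [← hz']
  exact hz

/-! ## §6 The marked levels: `F` on `T^{(k)}` versus `F` on `T/π^{e_k}T` (COFINAL letter `hιF`) -/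

/-- **At a marked index `i = e_k` a local class of `T^{(k)}` lies in `F` iff its image under the bijection
`H¹(K_v, proj)` lies in the refined condition.** [cite: Howard2004HeegnerKolyvagin, §1.6 (arXiv p. 11 L33–38, p. 12 L29–55)] -/
theorem mem_cond_iff_proj_mem_refinedCond (S : DVRSetting p K R N Rk Nbar Nq) (hy : S.SatisfiesH) {i k : ℕ}
    (hi : i = S.e k) (v : Place K) (c : galoisCohomology ((S.T.ρ k).toLocal v) 1) :
    c ∈ (S.t k).cond v ↔
      ((S.piRefinementDatum hy).isQuotientBy_levelRep (S.host_le_of_eq_e hy hi)).localCohomologyMap v 1 c ∈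
        S.refinedCond hy i v := by
  rw [S.refinedCond_apply_eq_map hy (S.host_le_of_eq_e hy hi) v]
  constructor
  · exact fun hc => AddSubgroup.mem_map_of_mem _ hc
  · rintro ⟨c', hc', h⟩
    have hinj := (bijective_cohomologyMap_of_bijective ((S.T.ρ k).toLocal v)
      (((S.piRefinementDatum hy).levelRep i).toLocal v) ((S.piRefinementDatum hy).proj (S.host_le_of_eq_e hy hi)).toAddMonoidHom
      (fun _ x => ((S.piRefinementDatum hy).isQuotientBy_levelRep (S.host_le_of_eq_e hy hi)).equivariant _ x)
      (S.proj_bijective_of_eq_e hy hi)).1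
    rwa [← hinj h]

end DVRSetting

end Literature.NumberTheory.GaloisCohomology.Howard2004

end
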